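import Summits.HubbardSuperconductivity.HubbardSuperconductivity.Theorems.AnisotropyChordTransferFibre3FinXDEvalW

/-!
# Route `AnisotropyChord` / H0 rotor rung: FIN per-`L` SIDE-CONDITION cell facts, `L = 14` (GM₃ cells 156–160)

Kernel facts `sdCellAnyZ 14 (49/50) 20 la lb (c, bn, aD) = true` (regime clause `mHole ≥ 0 ∧ facMI·η·(aD + b/(2+cos θ)) < c` on the cell, or vacuity), g5's `xbEval` objects, `decide +kernel`.
Prover seat `hubbard-h0-rotor-p3` g7; helper for piece A = stmt-HubbardSuperconductivity-23918 of rung 19089 (`--supports`, helper class).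
WHAT THIS IS NOT: nothing here proves superconductivity in the Hubbard model (rotor TARGET as worded stays FALSE, g15 verdict); kernel facts /
assembly for ONE conditional reduction at one `L`.  No sorry.
-/

set_option linter.dupNamespace false
set_option autoImplicit false

namespace Summit.HubbardSuperconductivity.HubbardSuperconductivity.Theorems.AnisotropyChord.Transfer.Fibre3

namespace FinXD

/-- side-condition cell `[11887939327478931, 12030594599408681]` of `L = 14` (`cert`). [folklore] -/
theorem sd14_156 : sdCellAnyZ 14 (49/50 : ℚ) 20 11887939327478931 12030594599408681 ((1/2 : ℚ), (29 : ℕ), (3/50 : ℚ)) = true := by (rw [← sdCellAnyZW_eq]; decide +kernel)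

/-- side-condition cell `[12030594599408681, 12174961734601585]` of `L = 14` (`cert`). [folklore] -/
theorem sd14_157 : sdCellAnyZ 14 (49/50 : ℚ) 20 12030594599408681 12174961734601585 ((1/2 : ℚ), (29 : ℕ), (3/50 : ℚ)) = true := by (rw [← sdCellAnyZW_eq]; decide +kernel)

/-- side-condition cell `[12174961734601585, 12321061275416805]` of `L = 14` (`cert`). [folklore] -/
theorem sd14_158 : sdCellAnyZ 14 (49/50 : ℚ) 20 12174961734601585 12321061275416805 ((1/2 : ℚ), (29 : ℕ), (3/50 : ℚ)) = true := by (rw [← sdCellAnyZW_eq]; decide +kernel)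

/-- side-condition cell `[12321061275416805, 18481591913125209]` of `L = 14` (`num`). [folklore] -/
theorem sd14_159 : sdCellAnyZ 14 (49/50 : ℚ) 20 12321061275416805 18481591913125209 ((1 : ℚ), (1 : ℕ), (1 : ℚ)) = true := by (rw [← sdCellAnyZW_eq]; decide +kernel)

/-- side-condition cell `[18481591913125209, 22804202716674880]` of `L = 14` (`num`). [folklore] -/
theorem sd14_160 : sdCellAnyZ 14 (49/50 : ℚ) 20 18481591913125209 22804202716674880 ((1 : ℚ), (1 : ℕ), (1 : ℚ)) = true := by (rw [← sdCellAnyZW_eq]; decide +kernel)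

end FinXD

end Summit.HubbardSuperconductivity.HubbardSuperconductivity.Theorems.AnisotropyChord.Transfer.Fibre3
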